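import Summits.ABC.ABC.Theorems.FeketeScalesScaleSubmultiplicativityGrowthExponent
import Summits.ABC.ABC.Theorems.FeketeScalesScaleSubmultiplicativityOfEnvelopeOfPowerShapes
import Literature.NumberTheory.DiophantineGeometry.AbcWave0BakerExplicitProofs

/-!
# Crux `ScaleSubmultiplicativity` (stmt-ABC-2160): normal forms — which of its parameters are structural

The crux of route `FeketeScales` (ABC/ABC) reads, G-free,
`∃ θ < 1, ∃ K > 0, ∃ R₀, ∀ R₁ R₂ ≥ R₀, ∀ abc triple T with rad T ≤ R₁R₂, ∃ abc triples T₁, T₂ with rad Tᵢ ≤ Rᵢ and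
c ≤ K · exp((log R₁R₂)^θ) · c₁ · c₂`, i.e. `G(R₁R₂) ≤ K e^{(log R₁R₂)^θ} G(R₁) G(R₂)` for the extremal height
`G(R) := max {c : abc triple, rad(abc) ≤ R}`.  It carries four parameters `(θ, K, R₀)` and the shape of the pairs
`(R₁, R₂)`.  This file records, as kernel facts attached to the crux (`--supports stmt-ABC-2160`), which of them are
structural.  All equivalences are unconditional (abc.S25, finiteness of the abc triples of bounded radical, is the
PROVED Literature fact `finite_setOf_isABCTriple_primeFactors_subset_holds`).

* `ScaleSubmultiplicativity.iff_extremalHeight` — **the G-form is the crux.**  For every extremal height `G`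
  (any `G : ℕ → ℕ` bounding the heights at each scale and attained at every scale `≥ 2`; one exists,
  `ScaleSubmultiplicativity.GrowthExponent.exists_extremalHeight`) the route decl is equivalent to
  `∃ θ < 1, ∃ K > 0, ∃ R₀, ∀ R₁ R₂ ≥ R₀, G(R₁R₂) ≤ K e^{(log R₁R₂)^θ} G(R₁) G(R₂)`.
* `ScaleSubmultiplicativity.iff_threshold_two` — **the threshold is cosmetic above 2.**  The crux is equivalent to
  its instance with `R₀ = 2` (every pair of scales `R₁, R₂ ≥ 2`, at the price of a larger `K`): below the threshold
  the finitely many heights are absorbed into `K` through the shadow `(1,1,2)` and the sub-additivity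
  `(log P R)^θ ≤ (log P)^θ + (log R)^θ`.  (Complement: `R₀ = 1` is false, `Cruxes/…/Disproof.lean`
  `false_without_R0`, because scale 1 carries no triple; so `R₀` is load-bearing exactly at `1 → 2`.)
* `ScaleSubmultiplicativity.iff_census` — the TESTABLE form of the item text made exact: with
  `K(θ) := sup_{2 ≤ R₁ ≤ R₂} G(R₁R₂) / (e^{(log R₁R₂)^θ} G(R₁) G(R₂)) ∈ [0, ∞]`, the crux holds iff `K(θ) < ∞`
  for some `θ ∈ [0,1)`; the measured `K(R₀, θ)` of the route's census (BarrierNotesIdeator3 §C) is its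
  truncation, and its trend in `R₀` calibrates `K`, never `R₀`.

Part II (`FeketeScalesScaleSubmultiplicativityNormalFormsConstants.lean`) adds: `K = 1` suffices when the threshold is
free (`iff_constant_one`), `θ` may be taken in `[t,1)` for any `t < 1` (`iff_exponent_ge`), ordered pairs `R₁ ≤ R₂`
suffice (`iff_ordered`).  So `θ` is the one structural parameter of stmt-ABC-2160; `K` and `R₀` trade against each
other and against `θ' - θ`.  These are CONSEQUENCE-FREE reformulations (no bearing on provability; cf.
`Cruxes/ScaleSubmultiplicativity/STRATEGY-CENSUS.md`): recorded so that refuters, the census, and the sibling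
items (`Assembly`, `PolynomialAbcOfSubmult`, `GrowthExponent`) may quote the crux in whichever normal form is
convenient.  Pattern: folklore manipulations of sub-additive sequences (Fekete 1923; Pólya–Szegő I, Problem 98).
-/

-- `Summit.<Summit>.<Problem>` is the mandated summit-side namespace (CONVENTIONS §2); for the
-- single-conjunct summit `ABC` the two coincide, so the duplicate `ABC.ABC` is deliberate.
set_option linter.dupNamespace false

namespace Summit.ABC.ABC.Theorems

open Literature.NumberTheory.DiophantineGeometry
open Summit.ABC.ABC.Theses.FeketeScales

namespace ScaleSubmultiplicativity.NormalForms

/-! ### Small helpers -/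

/-- `(1, 1, 2)` is an abc triple (the definition is symmetric in `a`, `b`). [folklore] -/
theorem isABCTriple_one_one_two : IsABCTriple 1 1 2 :=
  ⟨Nat.one_pos, Nat.one_pos, rfl, Nat.coprime_one_left 1⟩

/-- Sub-additivity of the slack exponent across a product of scales: for `x, y ≥ 1` and `0 ≤ θ ≤ 1`,
`(log (x y))^θ ≤ (log x)^θ + (log y)^θ`. [folklore] -/
theorem log_mul_rpow_le {x y θ : ℝ} (hx : 1 ≤ x) (hy : 1 ≤ y) (hθ0 : 0 ≤ θ) (hθ1 : θ ≤ 1) :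
    Real.log (x * y) ^ θ ≤ Real.log x ^ θ + Real.log y ^ θ := by
  rw [Real.log_mul (by positivity) (by positivity)]
  exact Real.rpow_add_le_add_rpow (Real.log_nonneg hx) (Real.log_nonneg hy) hθ0 hθ1

/-- Multiplicative form of `log_mul_rpow_le`: `exp((log xy)^θ) ≤ exp((log x)^θ) · exp((log y)^θ)`. [folklore] -/
theorem exp_log_mul_rpow_le {x y θ : ℝ} (hx : 1 ≤ x) (hy : 1 ≤ y) (hθ0 : 0 ≤ θ) (hθ1 : θ ≤ 1) :
    Real.exp (Real.log (x * y) ^ θ) ≤ Real.exp (Real.log x ^ θ) * Real.exp (Real.log y ^ θ) := by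
  rw [← Real.exp_add]
  exact Real.exp_le_exp.mpr (log_mul_rpow_le hx hy hθ0 hθ1)

/-- Monotonicity of the slack in the scale: `exp((log x)^θ) ≤ exp((log y)^θ)` for `1 ≤ x ≤ y`, `0 ≤ θ`.
[folklore] -/
theorem exp_log_rpow_mono {x y θ : ℝ} (hx : 1 ≤ x) (hxy : x ≤ y) (hθ : 0 ≤ θ) :
    Real.exp (Real.log x ^ θ) ≤ Real.exp (Real.log y ^ θ) :=
  Real.exp_le_exp.mpr (Real.rpow_le_rpow (Real.log_nonneg hx) (Real.log_le_log (by linarith) hxy) hθ)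

/-! ### The extremal height, abstractly

`G : ℕ → ℕ` is *an extremal height* when (i) every abc triple of radical `≤ R` has `c ≤ G R` and (ii) for `R ≥ 2`
the value `G R` is attained by an abc triple of radical `≤ R`.  Such a `G` exists
(`ScaleSubmultiplicativity.GrowthExponent.exists_extremalHeight`, from abc.S25) and (i)–(ii) determine `G R` for
`R ≥ 2` (it is the maximum of the heights).  No definition is introduced: every statement below quantifies over
such `G`. -/

/-- An extremal height is at least `2` at every scale `R ≥ 2` (the triple `(1,1,2)`). [folklore] -/
theorem two_le_extremal {G : ℕ → ℕ}
    (hGle : ∀ a b c R : ℕ, IsABCTriple a b c → rad a b c ≤ R → c ≤ G R) {R : ℕ} (hR : 2 ≤ R) :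
    2 ≤ G R :=
  hGle 1 1 2 R isABCTriple_one_one_two (by rw [rad_one_one_two]; exact hR)

/-- An extremal height is non-decreasing on the scales `≥ 2`. [folklore] -/
theorem extremal_mono {G : ℕ → ℕ}
    (hGle : ∀ a b c R : ℕ, IsABCTriple a b c → rad a b c ≤ R → c ≤ G R)
    (hGatt : ∀ R : ℕ, 2 ≤ R → ∃ a b : ℕ, IsABCTriple a b (G R) ∧ rad a b (G R) ≤ R)
    {R R' : ℕ} (hR : 2 ≤ R) (hRR' : R ≤ R') : G R ≤ G R' := by
  obtain ⟨a, b, hT, hr⟩ := hGatt R hR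
  exact hGle a b (G R) R' hT (hr.trans hRR')

/-- **G-free ⟹ G-form at one pair of scales.**  If every abc triple of radical `≤ R₁R₂` is shadowed with constant
`K ≥ 0` and exponent `θ`, then `G(R₁R₂) ≤ K e^{(log R₁R₂)^θ} G(R₁) G(R₂)` (apply the hypothesis to the triple
attaining `G(R₁R₂)`, which exists as soon as `R₁R₂ ≥ 2`). [folklore] -/
theorem extremal_le_of_free {G : ℕ → ℕ}
    (hGle : ∀ a b c R : ℕ, IsABCTriple a b c → rad a b c ≤ R → c ≤ G R)
    (hGatt : ∀ R : ℕ, 2 ≤ R → ∃ a b : ℕ, IsABCTriple a b (G R) ∧ rad a b (G R) ≤ R)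
    {θ K : ℝ} (hK : 0 ≤ K) {R₁ R₂ : ℕ} (h2 : 2 ≤ R₁ * R₂)
    (h : ∀ a b c : ℕ, IsABCTriple a b c → rad a b c ≤ R₁ * R₂ → ∃ a₁ b₁ c₁ a₂ b₂ c₂ : ℕ,
      IsABCTriple a₁ b₁ c₁ ∧ rad a₁ b₁ c₁ ≤ R₁ ∧ IsABCTriple a₂ b₂ c₂ ∧ rad a₂ b₂ c₂ ≤ R₂ ∧
      (c : ℝ) ≤ K * Real.exp (Real.log ((R₁ : ℝ) * R₂) ^ θ) * c₁ * c₂) :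
    (G (R₁ * R₂) : ℝ) ≤ K * Real.exp (Real.log ((R₁ : ℝ) * R₂) ^ θ) * G R₁ * G R₂ := by
  obtain ⟨a, b, hT, hr⟩ := hGatt (R₁ * R₂) h2
  obtain ⟨a₁, b₁, c₁, a₂, b₂, c₂, h₁, hr₁, h₂, hr₂, hc⟩ := h a b _ hT hr
  have hc₁ : (c₁ : ℝ) ≤ G R₁ := by exact_mod_cast hGle _ _ _ _ h₁ hr₁
  have hc₂ : (c₂ : ℝ) ≤ G R₂ := by exact_mod_cast hGle _ _ _ _ h₂ hr₂
  have h0 : 0 ≤ K * Real.exp (Real.log ((R₁ : ℝ) * R₂) ^ θ) := mul_nonneg hK (Real.exp_pos _).le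
  have h12 : (c₁ : ℝ) * c₂ ≤ (G R₁ : ℝ) * G R₂ := mul_le_mul hc₁ hc₂ (Nat.cast_nonneg _) (Nat.cast_nonneg _)
  calc (G (R₁ * R₂) : ℝ) ≤ K * Real.exp (Real.log ((R₁ : ℝ) * R₂) ^ θ) * c₁ * c₂ := hc
    _ = K * Real.exp (Real.log ((R₁ : ℝ) * R₂) ^ θ) * ((c₁ : ℝ) * c₂) := by ring
    _ ≤ K * Real.exp (Real.log ((R₁ : ℝ) * R₂) ^ θ) * ((G R₁ : ℝ) * G R₂) :=
        mul_le_mul_of_nonneg_left h12 h0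
    _ = K * Real.exp (Real.log ((R₁ : ℝ) * R₂) ^ θ) * G R₁ * G R₂ := by ring

/-- **G-form ⟹ G-free at one pair of scales `R₁, R₂ ≥ 2`.**  The witnesses are the triples attaining `G(R₁)`
and `G(R₂)`. [folklore] -/
theorem free_of_extremal_le {G : ℕ → ℕ}
    (hGle : ∀ a b c R : ℕ, IsABCTriple a b c → rad a b c ≤ R → c ≤ G R)
    (hGatt : ∀ R : ℕ, 2 ≤ R → ∃ a b : ℕ, IsABCTriple a b (G R) ∧ rad a b (G R) ≤ R)
    {θ K : ℝ} {R₁ R₂ : ℕ} (hR₁ : 2 ≤ R₁) (hR₂ : 2 ≤ R₂)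
    (h : (G (R₁ * R₂) : ℝ) ≤ K * Real.exp (Real.log ((R₁ : ℝ) * R₂) ^ θ) * G R₁ * G R₂) :
    ∀ a b c : ℕ, IsABCTriple a b c → rad a b c ≤ R₁ * R₂ → ∃ a₁ b₁ c₁ a₂ b₂ c₂ : ℕ,
      IsABCTriple a₁ b₁ c₁ ∧ rad a₁ b₁ c₁ ≤ R₁ ∧ IsABCTriple a₂ b₂ c₂ ∧ rad a₂ b₂ c₂ ≤ R₂ ∧
      (c : ℝ) ≤ K * Real.exp (Real.log ((R₁ : ℝ) * R₂) ^ θ) * c₁ * c₂ := by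
  intro a b c hT hr
  obtain ⟨a₁, b₁, h₁, hr₁⟩ := hGatt R₁ hR₁
  obtain ⟨a₂, b₂, h₂, hr₂⟩ := hGatt R₂ hR₂
  refine ⟨a₁, b₁, G R₁, a₂, b₂, G R₂, h₁, hr₁, h₂, hr₂, ?_⟩
  calc (c : ℝ) ≤ G (R₁ * R₂) := by exact_mod_cast hGle a b c _ hT hr
    _ ≤ _ := h

/-- **Threshold reduction in G-form.**  If `G(R₁R₂) ≤ e^L e^{(log R₁R₂)^θ} G(R₁) G(R₂)` for all `R₁, R₂ ≥ P`
(`P ≥ 2`, `0 ≤ θ < 1`... only `0 ≤ θ ≤ 1` is used), then the same holds for all `R₁, R₂ ≥ 2` with the constant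
`K' := e^L · G(P) · e^{(log P)^θ} + G(P²)`: for `R₁ < P ≤ R₂` use the pair `(P, R₂)`, monotonicity of `G`,
`(log P R₂)^θ ≤ (log P)^θ + (log R₁R₂)^θ` and `G(R₁) ≥ 2 ≥ 1`; for `R₁, R₂ < P` use `G(R₁R₂) ≤ G(P²)`. [folklore] -/
theorem extremal_threshold_two {G : ℕ → ℕ}
    (hGle : ∀ a b c R : ℕ, IsABCTriple a b c → rad a b c ≤ R → c ≤ G R)
    (hGatt : ∀ R : ℕ, 2 ≤ R → ∃ a b : ℕ, IsABCTriple a b (G R) ∧ rad a b (G R) ≤ R)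
    {θ L : ℝ} {P : ℕ} (hθ0 : 0 ≤ θ) (hθ1 : θ ≤ 1) (hP : 2 ≤ P)
    (h : ∀ R₁ R₂ : ℕ, P ≤ R₁ → P ≤ R₂ →
      (G (R₁ * R₂) : ℝ) ≤ Real.exp L * Real.exp (Real.log ((R₁ : ℝ) * R₂) ^ θ) * G R₁ * G R₂) :
    ∀ R₁ R₂ : ℕ, 2 ≤ R₁ → 2 ≤ R₂ →
      (G (R₁ * R₂) : ℝ) ≤ (Real.exp L * G P * Real.exp (Real.log (P : ℝ) ^ θ) + G (P * P)) *
        Real.exp (Real.log ((R₁ : ℝ) * R₂) ^ θ) * G R₁ * G R₂ := by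
  -- abbreviations and signs
  have hP1 : (1 : ℝ) ≤ P := by exact_mod_cast le_trans one_le_two hP
  have hGP0 : (0 : ℝ) ≤ G P := Nat.cast_nonneg _
  have hGPP0 : (0 : ℝ) ≤ G (P * P) := Nat.cast_nonneg _
  have hEP1 : 1 ≤ Real.exp (Real.log (P : ℝ) ^ θ) :=
    Real.one_le_exp (Real.rpow_nonneg (Real.log_nonneg hP1) _)
  have hexpL : 0 < Real.exp L := Real.exp_pos L
  have hA0 : 0 ≤ Real.exp L * G P * Real.exp (Real.log (P : ℝ) ^ θ) := by positivity
  have hK'1 : Real.exp L ≤ Real.exp L * G P * Real.exp (Real.log (P : ℝ) ^ θ) + G (P * P) := by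
    have hGP1 : (1 : ℝ) ≤ G P := by exact_mod_cast le_trans one_le_two (two_le_extremal hGle hP)
    have : Real.exp L * 1 * 1 ≤ Real.exp L * G P * Real.exp (Real.log (P : ℝ) ^ θ) :=
      mul_le_mul (mul_le_mul_of_nonneg_left hGP1 hexpL.le) hEP1 zero_le_one (by positivity)
    linarith
  have hK'2 : Real.exp L * G P * Real.exp (Real.log (P : ℝ) ^ θ) ≤
      Real.exp L * G P * Real.exp (Real.log (P : ℝ) ^ θ) + G (P * P) := le_add_of_nonneg_right hGPP0
  have hK'3 : (G (P * P) : ℝ) ≤ Real.exp L * G P * Real.exp (Real.log (P : ℝ) ^ θ) + G (P * P) :=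
    le_add_of_nonneg_left hA0
  intro R₁ R₂ hR₁ hR₂
  have hR₁1 : (1 : ℝ) ≤ R₁ := by exact_mod_cast le_trans one_le_two hR₁
  have hR₂1 : (1 : ℝ) ≤ R₂ := by exact_mod_cast le_trans one_le_two hR₂
  have hR₁2' : 2 ≤ R₁ * R₂ := hR₁.trans (Nat.le_mul_of_pos_right _ (by omega))
  have hF0 : 0 ≤ Real.exp (Real.log ((R₁ : ℝ) * R₂) ^ θ) := (Real.exp_pos _).le
  have hG₁0 : (0 : ℝ) ≤ G R₁ := Nat.cast_nonneg _
  have hG₂0 : (0 : ℝ) ≤ G R₂ := Nat.cast_nonneg _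
  have hG₁1 : (1 : ℝ) ≤ G R₁ := by exact_mod_cast le_trans one_le_two (two_le_extremal hGle hR₁)
  have hG₂1 : (1 : ℝ) ≤ G R₂ := by exact_mod_cast le_trans one_le_two (two_le_extremal hGle hR₂)
  rcases le_or_gt P R₁ with hP₁ | hP₁ <;> rcases le_or_gt P R₂ with hP₂ | hP₂
  · -- both scales above the threshold: only the constant grows
    calc (G (R₁ * R₂) : ℝ) ≤ Real.exp L * Real.exp (Real.log ((R₁ : ℝ) * R₂) ^ θ) * G R₁ * G R₂ :=
          h R₁ R₂ hP₁ hP₂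
      _ = Real.exp L * (Real.exp (Real.log ((R₁ : ℝ) * R₂) ^ θ) * G R₁ * G R₂) := by ring
      _ ≤ (Real.exp L * G P * Real.exp (Real.log (P : ℝ) ^ θ) + G (P * P)) *
            (Real.exp (Real.log ((R₁ : ℝ) * R₂) ^ θ) * G R₁ * G R₂) :=
          mul_le_mul_of_nonneg_right hK'1 (by positivity)
      _ = _ := by ring
  · -- `R₂ < P ≤ R₁`: use the pair `(R₁, P)`
    have hmono : G (R₁ * R₂) ≤ G (R₁ * P) :=
      extremal_mono hGle hGatt hR₁2' (Nat.mul_le_mul_left _ hP₂.le)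
    have hsplit : Real.exp (Real.log ((R₁ : ℝ) * P) ^ θ) ≤
        Real.exp (Real.log ((R₁ : ℝ) * R₂) ^ θ) * Real.exp (Real.log (P : ℝ) ^ θ) :=
      calc Real.exp (Real.log ((R₁ : ℝ) * P) ^ θ)
          ≤ Real.exp (Real.log (R₁ : ℝ) ^ θ) * Real.exp (Real.log (P : ℝ) ^ θ) :=
            exp_log_mul_rpow_le hR₁1 hP1 hθ0 hθ1
        _ ≤ Real.exp (Real.log ((R₁ : ℝ) * R₂) ^ θ) * Real.exp (Real.log (P : ℝ) ^ θ) :=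
            mul_le_mul_of_nonneg_right
              (exp_log_rpow_mono hR₁1 (le_mul_of_one_le_right (by linarith) hR₂1) hθ0) (Real.exp_pos _).le
    calc (G (R₁ * R₂) : ℝ) ≤ G (R₁ * P) := by exact_mod_cast hmono
      _ ≤ Real.exp L * Real.exp (Real.log ((R₁ : ℝ) * P) ^ θ) * G R₁ * G P := h R₁ P hP₁ le_rfl
      _ ≤ Real.exp L * (Real.exp (Real.log ((R₁ : ℝ) * R₂) ^ θ) * Real.exp (Real.log (P : ℝ) ^ θ)) *
            G R₁ * G P := by
          have := mul_le_mul_of_nonneg_left hsplit hexpL.le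
          exact mul_le_mul_of_nonneg_right (mul_le_mul_of_nonneg_right this hG₁0) hGP0
      _ = (Real.exp L * G P * Real.exp (Real.log (P : ℝ) ^ θ)) *
            (Real.exp (Real.log ((R₁ : ℝ) * R₂) ^ θ) * G R₁) * 1 := by ring
      _ ≤ (Real.exp L * G P * Real.exp (Real.log (P : ℝ) ^ θ) + G (P * P)) *
            (Real.exp (Real.log ((R₁ : ℝ) * R₂) ^ θ) * G R₁) * G R₂ :=
          mul_le_mul (mul_le_mul_of_nonneg_right hK'2 (by positivity)) hG₂1 zero_le_one (by positivity)
      _ = _ := by ring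
  · -- `R₁ < P ≤ R₂`: use the pair `(P, R₂)`
    have hmono : G (R₁ * R₂) ≤ G (P * R₂) :=
      extremal_mono hGle hGatt hR₁2' (Nat.mul_le_mul_right _ hP₁.le)
    have hsplit : Real.exp (Real.log ((P : ℝ) * R₂) ^ θ) ≤
        Real.exp (Real.log (P : ℝ) ^ θ) * Real.exp (Real.log ((R₁ : ℝ) * R₂) ^ θ) :=
      calc Real.exp (Real.log ((P : ℝ) * R₂) ^ θ)
          ≤ Real.exp (Real.log (P : ℝ) ^ θ) * Real.exp (Real.log (R₂ : ℝ) ^ θ) :=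
            exp_log_mul_rpow_le hP1 hR₂1 hθ0 hθ1
        _ ≤ Real.exp (Real.log (P : ℝ) ^ θ) * Real.exp (Real.log ((R₁ : ℝ) * R₂) ^ θ) :=
            mul_le_mul_of_nonneg_left
              (exp_log_rpow_mono hR₂1 (le_mul_of_one_le_left (by linarith) hR₁1) hθ0) (Real.exp_pos _).le
    calc (G (R₁ * R₂) : ℝ) ≤ G (P * R₂) := by exact_mod_cast hmono
      _ ≤ Real.exp L * Real.exp (Real.log ((P : ℝ) * R₂) ^ θ) * G P * G R₂ := h P R₂ le_rfl hP₂
      _ ≤ Real.exp L * (Real.exp (Real.log (P : ℝ) ^ θ) * Real.exp (Real.log ((R₁ : ℝ) * R₂) ^ θ)) *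
            G P * G R₂ := by
          have := mul_le_mul_of_nonneg_left hsplit hexpL.le
          exact mul_le_mul_of_nonneg_right (mul_le_mul_of_nonneg_right this hGP0) hG₂0
      _ = (Real.exp L * G P * Real.exp (Real.log (P : ℝ) ^ θ)) *
            (Real.exp (Real.log ((R₁ : ℝ) * R₂) ^ θ)) * 1 * G R₂ := by ring
      _ ≤ (Real.exp L * G P * Real.exp (Real.log (P : ℝ) ^ θ) + G (P * P)) *
            (Real.exp (Real.log ((R₁ : ℝ) * R₂) ^ θ)) * G R₁ * G R₂ :=
          mul_le_mul_of_nonneg_right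
            (mul_le_mul (mul_le_mul_of_nonneg_right hK'2 hF0) hG₁1 zero_le_one (by positivity)) hG₂0
  · -- both scales below the threshold: `G(R₁R₂) ≤ G(P²)`
    have hmono : G (R₁ * R₂) ≤ G (P * P) :=
      extremal_mono hGle hGatt hR₁2' (Nat.mul_le_mul hP₁.le hP₂.le)
    have hF1 : 1 ≤ Real.exp (Real.log ((R₁ : ℝ) * R₂) ^ θ) :=
      Real.one_le_exp (Real.rpow_nonneg (Real.log_nonneg (by nlinarith)) _)
    calc (G (R₁ * R₂) : ℝ) ≤ G (P * P) := by exact_mod_cast hmono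
      _ = (G (P * P) : ℝ) * 1 * 1 * 1 := by ring
      _ ≤ (Real.exp L * G P * Real.exp (Real.log (P : ℝ) ^ θ) + G (P * P)) *
            Real.exp (Real.log ((R₁ : ℝ) * R₂) ^ θ) * G R₁ * G R₂ :=
          mul_le_mul (mul_le_mul (mul_le_mul hK'3 hF1 zero_le_one (by positivity)) hG₁1 zero_le_one
            (by positivity)) hG₂1 zero_le_one (by positivity)

end ScaleSubmultiplicativity.NormalForms

open ScaleSubmultiplicativity.NormalForms

/-! ### The G-form is the crux -/

/-- **The G-form is the crux.**  For every extremal height `G` (heights bounded by `G R` at scale `R`, attained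
for `R ≥ 2`; one exists by `ScaleSubmultiplicativity.GrowthExponent.exists_extremalHeight`), the route decl
`ScaleSubmultiplicativity` (stmt-ABC-2160) is equivalent to
`∃ θ < 1, ∃ K > 0, ∃ R₀, ∀ R₁ R₂ ≥ R₀, G(R₁R₂) ≤ K · exp((log R₁R₂)^θ) · G(R₁) · G(R₂)`. [folklore] -/
theorem ScaleSubmultiplicativity.iff_extremalHeight (G : ℕ → ℕ)
    (hGle : ∀ a b c R : ℕ, IsABCTriple a b c → rad a b c ≤ R → c ≤ G R)
    (hGatt : ∀ R : ℕ, 2 ≤ R → ∃ a b : ℕ, IsABCTriple a b (G R) ∧ rad a b (G R) ≤ R) :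
    Summit.ABC.ABC.Theses.FeketeScales.ScaleSubmultiplicativity ↔
    ∃ θ : ℝ, θ < 1 ∧ ∃ K : ℝ, 0 < K ∧ ∃ R₀ : ℕ, ∀ R₁ R₂ : ℕ, R₀ ≤ R₁ → R₀ ≤ R₂ →
      (G (R₁ * R₂) : ℝ) ≤ K * Real.exp (Real.log ((R₁ : ℝ) * R₂) ^ θ) * G R₁ * G R₂ := by
  constructor
  · rintro ⟨θ, hθ1, K, hK, R₀, hS⟩
    refine ⟨θ, hθ1, K, hK, max R₀ 2, fun R₁ R₂ hR₁ hR₂ => ?_⟩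
    have h2 : 2 ≤ R₁ * R₂ :=
      ((le_max_right R₀ 2).trans hR₁).trans (Nat.le_mul_of_pos_right _ (by omega))
    exact extremal_le_of_free hGle hGatt hK.le h2
      (hS R₁ R₂ ((le_max_left _ _).trans hR₁) ((le_max_left _ _).trans hR₂))
  · rintro ⟨θ, hθ1, K, hK, R₀, hS⟩
    refine ⟨θ, hθ1, K, hK, max R₀ 2, fun R₁ R₂ hR₁ hR₂ => ?_⟩
    exact free_of_extremal_le hGle hGatt ((le_max_right _ _).trans hR₁) ((le_max_right _ _).trans hR₂)
      (hS R₁ R₂ ((le_max_left _ _).trans hR₁) ((le_max_left _ _).trans hR₂))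

/-! ### The threshold is cosmetic above `2` -/

/-- **Threshold `R₀ = 2` suffices.**  `ScaleSubmultiplicativity` (stmt-ABC-2160) is equivalent to its instance
with threshold `2` and `θ ∈ [0,1)`: every abc triple of radical `≤ R₁R₂`, for ANY `R₁, R₂ ≥ 2`, is shadowed.
(`R₀ = 1` is false — `Cruxes/ScaleSubmultiplicativity/Disproof.lean`, `false_without_R0` — since no abc triple has
radical `≤ 1`; so the threshold is load-bearing exactly at `1 → 2`, and above `2` it only trades against `K`:
`K' = K⁺ G(P) e^{(log P)^{θ⁺}} + G(P²)`, `P = max R₀ 2`.)  Uses abc.S25 (PROVED,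
`finite_setOf_isABCTriple_primeFactors_subset_holds`) through `GrowthExponent.exists_extremalHeight`. [folklore] -/
theorem ScaleSubmultiplicativity.iff_threshold_two :
    Summit.ABC.ABC.Theses.FeketeScales.ScaleSubmultiplicativity ↔
    ∃ θ : ℝ, 0 ≤ θ ∧ θ < 1 ∧ ∃ K : ℝ, 0 < K ∧ ∀ R₁ R₂ : ℕ, 2 ≤ R₁ → 2 ≤ R₂ → ∀ a b c : ℕ,
      IsABCTriple a b c → rad a b c ≤ R₁ * R₂ → ∃ a₁ b₁ c₁ a₂ b₂ c₂ : ℕ, IsABCTriple a₁ b₁ c₁ ∧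
        rad a₁ b₁ c₁ ≤ R₁ ∧ IsABCTriple a₂ b₂ c₂ ∧ rad a₂ b₂ c₂ ≤ R₂ ∧
        (c : ℝ) ≤ K * Real.exp (Real.log ((R₁ : ℝ) * R₂) ^ θ) * c₁ * c₂ := by
  obtain ⟨G, hGle, hGatt⟩ := ScaleSubmultiplicativity.GrowthExponent.exists_extremalHeight
  constructor
  · rintro ⟨θ, hθ1, K, hK, R₀, hS⟩
    -- normalise: `θ⁺ = max θ 0`, constant `e^L`, threshold `P = max R₀ 2`
    have hN := FeketeScalesAssembly.submult_normalise hK hS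
    set θ' : ℝ := max θ 0 with hθ'_def
    set L : ℝ := max (Real.log K) 0 with hL_def
    set P : ℕ := max R₀ 2 with hP_def
    have hθ'0 : 0 ≤ θ' := le_max_right _ _
    have hθ'1 : θ' < 1 := max_lt hθ1 one_pos
    have hP2 : 2 ≤ P := le_max_right _ _
    -- G-form above the threshold `P`
    have hGform : ∀ R₁ R₂ : ℕ, P ≤ R₁ → P ≤ R₂ →
        (G (R₁ * R₂) : ℝ) ≤ Real.exp L * Real.exp (Real.log ((R₁ : ℝ) * R₂) ^ θ') * G R₁ * G R₂ := by
      intro R₁ R₂ hR₁ hR₂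
      have h2 : 2 ≤ R₁ * R₂ := (hP2.trans hR₁).trans (Nat.le_mul_of_pos_right _ (by omega))
      exact extremal_le_of_free hGle hGatt (Real.exp_pos L).le h2 (hN R₁ R₂ hR₁ hR₂)
    -- threshold reduction in G-form, then back to the G-free form
    have hred := extremal_threshold_two hGle hGatt hθ'0 hθ'1.le hP2 hGform
    have hK'pos : 0 < Real.exp L * G P * Real.exp (Real.log (P : ℝ) ^ θ') + G (P * P) := by
      have : (0 : ℝ) < G (P * P) := by
        have := two_le_extremal hGle (hP2.trans (Nat.le_mul_of_pos_right _ (by omega)) : 2 ≤ P * P)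
        exact_mod_cast lt_of_lt_of_le two_pos this
      positivity
    refine ⟨θ', hθ'0, hθ'1, _, hK'pos, fun R₁ R₂ hR₁ hR₂ => ?_⟩
    exact free_of_extremal_le hGle hGatt hR₁ hR₂ (hred R₁ R₂ hR₁ hR₂)
  · rintro ⟨θ, -, hθ1, K, hK, hS⟩
    exact ⟨θ, hθ1, K, hK, 2, hS⟩

/-! ### The census form -/

/-- **The census form of the crux.**  For every extremal height `G`, `ScaleSubmultiplicativity` (stmt-ABC-2160)
holds iff for some `θ ∈ [0,1)` the census constant at threshold `2`,
`K(θ) := sup_{2 ≤ R₁ ≤ R₂} G(R₁R₂) / (exp((log R₁R₂)^θ) G(R₁) G(R₂))`, is finite — i.e. iff some real `K` bounds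
`G(R₁R₂) ≤ K exp((log R₁R₂)^θ) G(R₁) G(R₂)` over ALL ordered pairs `2 ≤ R₁ ≤ R₂`.  (The route's finite-table
quantity `K(R₀, θ)` of the item text, BarrierNotesIdeator3 §C, is the truncation of `K(θ)` to `R₀ ≤ R₁ ≤ R₂`,
`R₁R₂ ≤ X`; by `iff_threshold_two` its dependence on `R₀` calibrates `K` only.) [folklore] -/
theorem ScaleSubmultiplicativity.iff_census (G : ℕ → ℕ)
    (hGle : ∀ a b c R : ℕ, IsABCTriple a b c → rad a b c ≤ R → c ≤ G R)
    (hGatt : ∀ R : ℕ, 2 ≤ R → ∃ a b : ℕ, IsABCTriple a b (G R) ∧ rad a b (G R) ≤ R) :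
    Summit.ABC.ABC.Theses.FeketeScales.ScaleSubmultiplicativity ↔
    ∃ θ : ℝ, 0 ≤ θ ∧ θ < 1 ∧ ∃ K : ℝ, ∀ R₁ R₂ : ℕ, 2 ≤ R₁ → R₁ ≤ R₂ →
      (G (R₁ * R₂) : ℝ) ≤ K * Real.exp (Real.log ((R₁ : ℝ) * R₂) ^ θ) * G R₁ * G R₂ := by
  rw [ScaleSubmultiplicativity.iff_threshold_two]
  constructor
  · rintro ⟨θ, hθ0, hθ1, K, hK, hS⟩
    refine ⟨θ, hθ0, hθ1, K, fun R₁ R₂ hR₁ h12 => ?_⟩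
    have hR₂ : 2 ≤ R₂ := hR₁.trans h12
    have h2 : 2 ≤ R₁ * R₂ := hR₁.trans (Nat.le_mul_of_pos_right _ (by omega))
    exact extremal_le_of_free hGle hGatt hK.le h2 (hS R₁ R₂ hR₁ hR₂)
  · rintro ⟨θ, hθ0, hθ1, K, hS⟩
    -- enlarge `K` to a positive constant and symmetrise
    have hS' : ∀ R₁ R₂ : ℕ, 2 ≤ R₁ → 2 ≤ R₂ →
        (G (R₁ * R₂) : ℝ) ≤ max K 1 * Real.exp (Real.log ((R₁ : ℝ) * R₂) ^ θ) * G R₁ * G R₂ := by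
      have hup : ∀ R₁ R₂ : ℕ, 2 ≤ R₁ → R₁ ≤ R₂ →
          (G (R₁ * R₂) : ℝ) ≤ max K 1 * Real.exp (Real.log ((R₁ : ℝ) * R₂) ^ θ) * G R₁ * G R₂ := by
        intro R₁ R₂ hR₁ h12
        have h0 : 0 ≤ Real.exp (Real.log ((R₁ : ℝ) * R₂) ^ θ) * G R₁ * G R₂ := by positivity
        calc (G (R₁ * R₂) : ℝ) ≤ K * Real.exp (Real.log ((R₁ : ℝ) * R₂) ^ θ) * G R₁ * G R₂ :=
              hS R₁ R₂ hR₁ h12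
          _ = K * (Real.exp (Real.log ((R₁ : ℝ) * R₂) ^ θ) * G R₁ * G R₂) := by ring
          _ ≤ max K 1 * (Real.exp (Real.log ((R₁ : ℝ) * R₂) ^ θ) * G R₁ * G R₂) :=
              mul_le_mul_of_nonneg_right (le_max_left _ _) h0
          _ = _ := by ring
      intro R₁ R₂ hR₁ hR₂
      rcases le_total R₁ R₂ with h12 | h21
      · exact hup R₁ R₂ hR₁ h12
      · calc (G (R₁ * R₂) : ℝ) = G (R₂ * R₁) := by rw [Nat.mul_comm]
          _ ≤ max K 1 * Real.exp (Real.log ((R₂ : ℝ) * R₁) ^ θ) * G R₂ * G R₁ := hup R₂ R₁ hR₂ h21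
          _ = max K 1 * Real.exp (Real.log ((R₁ : ℝ) * R₂) ^ θ) * G R₁ * G R₂ := by
              rw [mul_comm (R₂ : ℝ)]; ring
    refine ⟨θ, hθ0, hθ1, max K 1, lt_of_lt_of_le one_pos (le_max_right _ _), fun R₁ R₂ hR₁ hR₂ => ?_⟩
    exact free_of_extremal_le hGle hGatt hR₁ hR₂ (hS' R₁ R₂ hR₁ hR₂)

end Summit.ABC.ABC.Theorems
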